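import Summits.ResolutionOfSingularities.ResolutionOfSingularities.Theorems.EquisingularLiftEquisingularLiftNatLiftCoreLocal
import HarnessLib

/-!
# [OURS · L1 W4.5(b) · EL♮] LIFT-50 LOCAL CORE, part 2: sufficiency at a SINGULAR hypersurface point, and the criterion
# (crux `EquisingularLiftNat` = stmt-ResolutionOfSingularities-20038; PARENT ≥ 4 band / kill test #50 K5-BMY; object (ε))

HONEST FRAMING. OURS (cell res-hironaka, crux chain w45b, slot W4.5(b)); NOT a statement of any manuscript; replaces the role of
NOTHING in the manuscript; AI-written, AI review is weaker than expert review. Helper `--supports stmt-ResolutionOfSingularities-20038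
--as helper`. Continues `…NatLiftCoreLocal` (necessity `not_mem_mul_of_sup_span_eq`, persistence, regular case); memo
`L/res-L1-w45b-lead-1/LIFT50-CORE.md`.

* `exists_lift_of_span_range_sup` — `I = (f₁, …, f_c) + (h)`, `df` independent, `h ∈ 𝔪² ∖ (f)` (a SINGULAR hypersurface `X` in the
  regular germ `V(f)`), `ϖ ∈ I ∖ 𝔪 I` ⟹ a regular `O`-flat local lift `J` exists (correct one member of the family by `h`, or keep `(f)`).
* `exists_regular_flat_lift` — the general sufficiency for `I = J₀ + (h)` with `R ⧸ J₀` regular (normalise via the tree's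
  `exists_span_eq_of_isRegularLocalRing_quotient`, then the regular / singular case).
* `exists_regular_flat_lift_iff` — THE LOCAL CORE: for `X` of embedded hypersurface type at `x`, a regular `O`-flat local lift with
  special fibre `X` exists ⟺ `ϖ ∉ 𝔪_x · I_{X,x}`.

References: Matsumura, Commutative Ring Theory, Thm. 14.2 [Matsumura1987]; tree `RegularQuotientIdeal.lean`. [folklore]
-/

set_option linter.dupNamespace false -- mandated namespace `Summit.<Summit>.<Problem>` of this single-conjunct summit

universe u

open IsLocalRing Module
open Literature.AlgebraicGeometry.Resolution

namespace Summit.ResolutionOfSingularities.ResolutionOfSingularities.Cruxes.EquisingularLiftNat.Sections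

namespace LiftCore

section Sufficiency

variable {R : Type u} [CommRing R] [IsRegularLocalRing R]

/-- **Singular hypersurface case.** `I = (f₁, …, f_c) + (h)` with `df` independent, `h ∈ 𝔪²`, `h ∉ (f)` (so `X = V(I)` is a
SINGULAR hypersurface in the regular germ `V(f)`), `ϖ ∈ I ∖ 𝔪 I`. Writing `ϖ = Σ bᵢ fᵢ + a h`: if `a` is a unit, `J := (f)` lifts;
otherwise some `bᵢ₀` is a unit and `J := (f₁, …, fᵢ₀ + h, …, f_c)` lifts (same differentials ⇒ regular; `(a − bᵢ₀) h ∈ J + (ϖ)` with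
`a − bᵢ₀` a unit ⇒ `J + (ϖ) = I`; `ϖ ∈ J` would force `h ∈ (f)` or `bᵢ₀ ∈ 𝔪`). OURS. [folklore] -/
theorem exists_lift_of_span_range_sup {c : ℕ} (f : Fin c → R) (hf : ∀ i, f i ∈ maximalIdeal R)
    (hli : LinearIndependent (ResidueField R) fun i => (maximalIdeal R).toCotangent ⟨f i, hf i⟩)
    {h : R} (hh2 : h ∈ maximalIdeal R ^ 2) (hhf : h ∉ Ideal.span (Set.range f))
    {ϖ : R} (hϖI : ϖ ∈ Ideal.span (Set.range f) ⊔ Ideal.span {h})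
    (hϖ : ϖ ∉ maximalIdeal R * (Ideal.span (Set.range f) ⊔ Ideal.span {h})) :
    ∃ J ≤ Ideal.span (Set.range f) ⊔ Ideal.span {h}, IsRegularLocalRing (R ⧸ J) ∧ ϖ ∉ J ∧
      J ⊔ Ideal.span {ϖ} = Ideal.span (Set.range f) ⊔ Ideal.span {h} := by
  classical
  set I := Ideal.span (Set.range f) ⊔ Ideal.span {h} with hIdef
  have hfI : ∀ i, f i ∈ I := fun i => Ideal.mem_sup_left (Ideal.subset_span ⟨i, rfl⟩)
  have hhI : h ∈ I := Ideal.mem_sup_right (Ideal.mem_span_singleton_self h)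
  have hhm : h ∈ maximalIdeal R := Ideal.pow_le_self two_ne_zero hh2
  obtain ⟨j, hj, z, hz, hjz⟩ := Submodule.mem_sup.mp hϖI
  obtain ⟨a, rfl⟩ := Ideal.mem_span_singleton'.mp hz
  obtain ⟨b, rfl⟩ := Ideal.mem_span_range_iff_exists_fun.mp hj
  -- so `ϖ = Σ bᵢ fᵢ + a h`
  by_cases ha : a ∈ maximalIdeal R
  · -- some `bᵢ₀` is a unit
    obtain ⟨i₀, hi₀⟩ : ∃ i₀, b i₀ ∉ maximalIdeal R := by
      by_contra hall
      push Not at hall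
      apply hϖ
      rw [← hjz]
      exact Ideal.add_mem _ (sum_mul_mem_mul _ b f (fun i _ => hall i) (fun i _ => hfI i))
        (Ideal.mul_mem_mul ha hhI)
    have hbu : IsUnit (b i₀) := (IsLocalRing.notMem_maximalIdeal).mp hi₀
    -- the corrected family
    let f' : Fin c → R := fun i => f i + if i = i₀ then h else 0
    have hf' : ∀ i, f' i ∈ maximalIdeal R := fun i => by
      by_cases hi : i = i₀ <;> simp only [f', hi, if_true, if_false, add_zero]
      exacts [Ideal.add_mem _ (hf _) hhm, hf i]
    have hdf' : (fun i => (maximalIdeal R).toCotangent ⟨f' i, hf' i⟩) =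
        fun i => (maximalIdeal R).toCotangent ⟨f i, hf i⟩ := by
      funext i
      rw [Ideal.toCotangent_eq]
      by_cases hi : i = i₀ <;> simp only [f', hi, if_true, if_false, add_zero, add_sub_cancel_left, sub_self]
      exacts [hh2, Ideal.zero_mem _]
    have hli' : LinearIndependent (ResidueField R) fun i => (maximalIdeal R).toCotangent ⟨f' i, hf' i⟩ := by
      rw [hdf']; exact hli
    have hf'I : ∀ i, f' i ∈ I := fun i => by
      by_cases hi : i = i₀ <;> simp only [f', hi, if_true, if_false, add_zero]
      exacts [Ideal.add_mem _ (hfI _) hhI, hfI i]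
    have hsum' : ∑ i, b i * f' i = ∑ i, b i * f i + b i₀ * h := by
      simp only [f', mul_add, Finset.sum_add_distrib, mul_ite, mul_zero, Finset.sum_ite_eq', Finset.mem_univ,
        if_true]
    -- key identity: `ϖ = Σ bᵢ f'ᵢ + (a - bᵢ₀) h`
    have hkey : ∑ i, b i * f i + a * h = ∑ i, b i * f' i + (a - b i₀) * h := by rw [hsum']; ring
    have habu : IsUnit (a - b i₀) := by
      refine (IsLocalRing.notMem_maximalIdeal).mp fun hab => hi₀ ?_
      have : b i₀ = a - (a - b i₀) := by ring
      rw [this]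
      exact Ideal.sub_mem _ ha hab
    refine ⟨Ideal.span (Set.range f'), ?_, ?_, ?_, ?_⟩
    · rw [Ideal.span_le]; rintro _ ⟨i, rfl⟩; exact hf'I i
    · have := isRegularLocalRing_quotient_span_image_of_linearIndependent_toCotangent f' hf' hli' Set.univ
      rwa [Set.image_univ] at this
    · -- `ϖ ∉ J`
      intro hϖJ
      obtain ⟨e, he⟩ := Ideal.mem_span_range_iff_exists_fun.mp hϖJ
      have hsume : ∑ i, e i * f' i = ∑ i, e i * f i + e i₀ * h := by
        simp only [f', mul_add, Finset.sum_add_distrib, mul_ite, mul_zero, Finset.sum_ite_eq', Finset.mem_univ,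
          if_true]
      -- `Σ (bᵢ - eᵢ) fᵢ = (eᵢ₀ - a) h`
      have hdiff : ∑ i, (b i - e i) * f i = (e i₀ - a) * h := by
        have h1 : ∑ i, (b i - e i) * f i = ∑ i, b i * f i - ∑ i, e i * f i := by
          simp only [sub_mul, Finset.sum_sub_distrib]
        rw [h1]
        have h2 : ∑ i, e i * f i = ∑ i, b i * f i + a * h - e i₀ * h := by
          rw [hjz, ← he, hsume]; ring
        rw [h2]; ring
      by_cases hea : e i₀ - a ∈ maximalIdeal R
      · -- then `Σ (bᵢ - eᵢ) fᵢ ∈ 𝔪²`, so `bᵢ₀ - eᵢ₀ ∈ 𝔪`, and `eᵢ₀ ∈ 𝔪`: contradiction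
        have hsq : ∑ i, (b i - e i) * f i ∈ maximalIdeal R ^ 2 := by
          rw [hdiff, pow_two]
          exact Ideal.mul_mem_mul hea hhm
        have hbe := mem_maximalIdeal_of_sum_mul_mem_sq f hf hli _ hsq i₀
        have hei : e i₀ ∈ maximalIdeal R := by
          have : e i₀ = (e i₀ - a) + a := by ring
          rw [this]; exact Ideal.add_mem _ hea ha
        apply hi₀
        have : b i₀ = (b i₀ - e i₀) + e i₀ := by ring
        rw [this]; exact Ideal.add_mem _ hbe hei
      · -- then `h ∈ (f)`: contradiction
        have heu : IsUnit (e i₀ - a) := (IsLocalRing.notMem_maximalIdeal).mp hea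
        apply hhf
        have : h = ↑heu.unit⁻¹ * ((e i₀ - a) * h) := by
          rw [← mul_assoc, IsUnit.val_inv_mul, one_mul]
        rw [this, ← hdiff]
        exact Ideal.mul_mem_left _ _ (Ideal.sum_mem _ fun i _ =>
          Ideal.mul_mem_left _ _ (Ideal.subset_span ⟨i, rfl⟩))
    · -- `J + (ϖ) = I`
      apply le_antisymm
      · refine sup_le ?_ ((Ideal.span_singleton_le_iff_mem _).mpr hϖI)
        rw [Ideal.span_le]; rintro _ ⟨i, rfl⟩; exact hf'I i
      · have hϖK : ∑ i, b i * f i + a * h ∈ Ideal.span (Set.range f') ⊔ Ideal.span {ϖ} :=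
          hjz ▸ Ideal.mem_sup_right (Ideal.mem_span_singleton_self _)
        have hsumK : ∑ i, b i * f' i ∈ Ideal.span (Set.range f') ⊔ Ideal.span {ϖ} :=
          Ideal.mem_sup_left (Ideal.sum_mem _ fun i _ => Ideal.mul_mem_left _ _ (Ideal.subset_span ⟨i, rfl⟩))
        have hhK : h ∈ Ideal.span (Set.range f') ⊔ Ideal.span {ϖ} := by
          have h1 : (a - b i₀) * h ∈ Ideal.span (Set.range f') ⊔ Ideal.span {ϖ} := by
            have : (a - b i₀) * h = (∑ i, b i * f i + a * h) - ∑ i, b i * f' i := by rw [hkey]; ring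
            rw [this]; exact Ideal.sub_mem _ hϖK hsumK
          have : h = ↑habu.unit⁻¹ * ((a - b i₀) * h) := by
            rw [← mul_assoc, IsUnit.val_inv_mul, one_mul]
          rw [this]; exact Ideal.mul_mem_left _ _ h1
        have hfK : ∀ i, f i ∈ Ideal.span (Set.range f') ⊔ Ideal.span {ϖ} := fun i => by
          have hf'i : f' i ∈ Ideal.span (Set.range f') ⊔ Ideal.span {ϖ} :=
            Ideal.mem_sup_left (Ideal.subset_span ⟨i, rfl⟩)
          by_cases hi : i = i₀
          · have : f i = f' i - h := by simp only [f', hi, if_true, add_sub_cancel_right]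
            rw [this]; exact Ideal.sub_mem _ hf'i hhK
          · have : f i = f' i := by simp only [f', hi, if_false, add_zero]
            rw [this]; exact hf'i
        refine sup_le ?_ ((Ideal.span_singleton_le_iff_mem _).mpr hhK)
        rw [Ideal.span_le]; rintro _ ⟨i, rfl⟩; exact hfK i
  · -- `a` is a unit: `J := (f)` lifts
    have hau : IsUnit a := (IsLocalRing.notMem_maximalIdeal).mp ha
    refine ⟨Ideal.span (Set.range f), le_sup_left, ?_, ?_, ?_⟩
    · have := isRegularLocalRing_quotient_span_image_of_linearIndependent_toCotangent f hf hli Set.univ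
      rwa [Set.image_univ] at this
    · intro hϖJ
      apply hhf
      have h1 : a * h ∈ Ideal.span (Set.range f) := by
        have : a * h = ϖ - ∑ i, b i * f i := by rw [← hjz]; ring
        rw [this]; exact Ideal.sub_mem _ hϖJ hj
      have : h = ↑hau.unit⁻¹ * (a * h) := by rw [← mul_assoc, IsUnit.val_inv_mul, one_mul]
      rw [this]; exact Ideal.mul_mem_left _ _ h1
    · apply le_antisymm
      · exact sup_le le_sup_left ((Ideal.span_singleton_le_iff_mem _).mpr hϖI)
      · refine sup_le le_sup_left ((Ideal.span_singleton_le_iff_mem _).mpr ?_)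
        have h1 : a * h ∈ Ideal.span (Set.range f) ⊔ Ideal.span {ϖ} := by
          have : a * h = ϖ - ∑ i, b i * f i := by rw [← hjz]; ring
          rw [this]
          exact Ideal.sub_mem _ (Ideal.mem_sup_right (Ideal.mem_span_singleton_self _)) (Ideal.mem_sup_left hj)
        have : h = ↑hau.unit⁻¹ * (a * h) := by rw [← mul_assoc, IsUnit.val_inv_mul, one_mul]
        rw [this]; exact Ideal.mul_mem_left _ _ h1

/-- **LIFT-50 LOCAL CORE, sufficiency.** `R` regular local, `I ≤ 𝔪` of EMBEDDED HYPERSURFACE TYPE — `I = J₀ + (h)` with `R ⧸ J₀`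
regular (`X = V(I)` is a hypersurface, possibly trivial, in the regular germ `V(J₀)`) — and `ϖ ∈ I` with `ϖ ∉ 𝔪·I`. Then there is a
regular `O`-flat local lift: `J ≤ I` with `R ⧸ J` a regular local ring, `ϖ ∉ J` and `J + (ϖ) = I` (so `V(J)` is regular, `ϖ` is a
non-zero-divisor on the domain `R ⧸ J`, and `V(J) ∩ V(ϖ) = X` scheme-theoretically). Proof: generators `f` of `J₀` with independent
differentials (tree `exists_span_eq_of_isRegularLocalRing_quotient`); if `dh ∉ ⟨df⟩` enlarge the family by `h` (regular case), else
correct `h` into `𝔪²`; then `exists_lift_of_span_range` / `exists_lift_of_span_range_sup`. OURS. [folklore] -/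
theorem exists_regular_flat_lift {I J₀ : Ideal R} {h ϖ : R} (hI : I ≤ maximalIdeal R) [hJ₀ : IsRegularLocalRing (R ⧸ J₀)]
    (hIJ : I = J₀ ⊔ Ideal.span {h}) (hϖI : ϖ ∈ I) (hϖ : ϖ ∉ maximalIdeal R * I) :
    ∃ J ≤ I, IsRegularLocalRing (R ⧸ J) ∧ ϖ ∉ J ∧ J ⊔ Ideal.span {ϖ} = I := by
  classical
  have hJ₀I : J₀ ≤ I := hIJ ▸ le_sup_left
  have hJ₀m : J₀ ≤ maximalIdeal R := hJ₀I.trans hI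
  have hhI : h ∈ I := hIJ ▸ Ideal.mem_sup_right (Ideal.mem_span_singleton_self h)
  have hhm : h ∈ maximalIdeal R := hI hhI
  obtain ⟨c, f, hfG, hspan, hli⟩ :=
    exists_span_eq_of_isRegularLocalRing_quotient hJ₀m (J₀ : Set R) (Ideal.span_eq J₀)
  have hf : ∀ i, f i ∈ maximalIdeal R := fun i => hJ₀m (hspan ▸ Ideal.subset_span ⟨i, rfl⟩)
  have hli : LinearIndependent (ResidueField R) fun i => (maximalIdeal R).toCotangent ⟨f i, hf i⟩ := hli
  rw [← hspan] at hIJ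
  by_cases hdh : (maximalIdeal R).toCotangent ⟨h, hhm⟩ ∈
      Submodule.span (ResidueField R) (Set.range fun i => (maximalIdeal R).toCotangent ⟨f i, hf i⟩)
  · -- correct `h` into `𝔪²`
    obtain ⟨ebar, hebar⟩ := (Submodule.mem_span_range_iff_exists_fun _).mp hdh
    obtain ⟨e, he⟩ : ∃ e : Fin c → R, ∀ i, residue R (e i) = ebar i :=
      ⟨fun i => (Ideal.Quotient.mk_surjective (ebar i)).choose,
        fun i => (Ideal.Quotient.mk_surjective (ebar i)).choose_spec⟩
    set h₂ := h - ∑ i, e i * f i with hh₂def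
    have hsumJ : ∑ i, e i * f i ∈ Ideal.span (Set.range f) :=
      Ideal.sum_mem _ fun i _ => Ideal.mul_mem_left _ _ (Ideal.subset_span ⟨i, rfl⟩)
    have hsumm : ∑ i, e i * f i ∈ maximalIdeal R := Ideal.sum_mem _ fun i _ => Ideal.mul_mem_left _ _ (hf i)
    have hh₂2 : h₂ ∈ maximalIdeal R ^ 2 := by
      have hsub : h₂ ∈ maximalIdeal R := Ideal.sub_mem _ hhm hsumm
      rw [← Ideal.toCotangent_eq_zero _ ⟨h₂, hsub⟩]
      have heq : (⟨h₂, hsub⟩ : maximalIdeal R) = ⟨h, hhm⟩ - ∑ i, e i • (⟨f i, hf i⟩ : maximalIdeal R) := by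
        apply Subtype.ext
        simp only [hh₂def, AddSubgroupClass.coe_sub, AddSubmonoidClass.coe_finsetSum, SetLike.val_smul, smul_eq_mul]
      rw [heq, map_sub, map_sum, ← hebar, sub_eq_zero]
      refine Finset.sum_congr rfl fun i _ => ?_
      rw [LinearMap.map_smul_of_tower, ← he i]
      exact algebraMap_smul (ResidueField R) (e i) _
    have hIeq : Ideal.span (Set.range f) ⊔ Ideal.span {h} = Ideal.span (Set.range f) ⊔ Ideal.span {h₂} := by
      apply le_antisymm
      · refine sup_le le_sup_left ((Ideal.span_singleton_le_iff_mem _).mpr ?_)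
        have : h = h₂ + ∑ i, e i * f i := by rw [hh₂def]; ring
        rw [this]
        exact Ideal.add_mem _ (Ideal.mem_sup_right (Ideal.mem_span_singleton_self _)) (Ideal.mem_sup_left hsumJ)
      · refine sup_le le_sup_left ((Ideal.span_singleton_le_iff_mem _).mpr ?_)
        exact Ideal.sub_mem _ (Ideal.mem_sup_right (Ideal.mem_span_singleton_self _)) (Ideal.mem_sup_left hsumJ)
    rw [hIeq] at hIJ
    subst hIJ
    by_cases hh₂f : h₂ ∈ Ideal.span (Set.range f)
    · -- regular case: `I = (f)`
      have hIeq' : Ideal.span (Set.range f) ⊔ Ideal.span {h₂} = Ideal.span (Set.range f) :=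
        sup_eq_left.mpr ((Ideal.span_singleton_le_iff_mem _).mpr hh₂f)
      rw [hIeq'] at hϖI hϖ ⊢
      exact exists_lift_of_span_range f hf hli hϖI hϖ
    · exact exists_lift_of_span_range_sup f hf hli hh₂2 hh₂f hϖI hϖ
  · -- regular case with the enlarged family `(h, f₁, …, f_c)`
    let g : Fin (c + 1) → R := Fin.cons h f
    have hg : ∀ i, g i ∈ maximalIdeal R := fun i => by
      refine Fin.cases ?_ (fun j => ?_) i
      · simpa [g] using hhm
      · simpa [g] using hf j
    have hdg : (fun i => (maximalIdeal R).toCotangent ⟨g i, hg i⟩) =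
        Fin.cons ((maximalIdeal R).toCotangent ⟨h, hhm⟩) (fun i => (maximalIdeal R).toCotangent ⟨f i, hf i⟩) := by
      funext i
      refine Fin.cases ?_ (fun j => ?_) i
      · simp only [Fin.cons_zero]; rfl
      · simp only [Fin.cons_succ]; rfl
    have hlig : LinearIndependent (ResidueField R) fun i => (maximalIdeal R).toCotangent ⟨g i, hg i⟩ := by
      rw [hdg]
      exact linearIndependent_finCons.mpr ⟨hli, hdh⟩
    have hIg : Ideal.span (Set.range f) ⊔ Ideal.span {h} = Ideal.span (Set.range g) := by
      rw [show Set.range g = insert h (Set.range f) from Fin.range_cons h f, Ideal.span_insert, sup_comm]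
    rw [hIg] at hIJ
    subst hIJ
    exact exists_lift_of_span_range g hg hlig hϖI hϖ

/-- **The criterion (iff form), embedded hypersurface type.** OURS. [folklore] -/
theorem exists_regular_flat_lift_iff {I J₀ : Ideal R} {h ϖ : R} (hI : I ≤ maximalIdeal R) [IsRegularLocalRing (R ⧸ J₀)]
    (hIJ : I = J₀ ⊔ Ideal.span {h}) (hϖI : ϖ ∈ I) :
    (∃ J ≤ I, IsRegularLocalRing (R ⧸ J) ∧ ϖ ∉ J ∧ J ⊔ Ideal.span {ϖ} = I) ↔ ϖ ∉ maximalIdeal R * I :=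
  ⟨fun ⟨J, hJI, _, hϖJ, hJ⟩ => not_mem_mul_of_exists_lift ⟨J, hJI, hϖJ, hJ⟩,
    fun hϖ => exists_regular_flat_lift hI hIJ hϖI hϖ⟩

end Sufficiency

end LiftCore

end Summit.ResolutionOfSingularities.ResolutionOfSingularities.Cruxes.EquisingularLiftNat.Sections
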